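import Mathlib
import HarnessLib
import HarnessLib.Audit
import Summits.ValiantsHypothesis.ValiantsHypothesis.Theorems.LacunarySymmetroidMatrixDescartesZeroChangeConcavityBudgetFloor

/-!
# ValiantsHypothesis / LacunarySymmetroid — crux `MatrixDescartes` (stmt-ValiantsHypothesis-18050, V1), LINE (A) «product_plus_one»:
# the DIP BUDGET — `OneChangeFloorK3` follows from a LINEAR budget on the DIPS (off-root critical points with `Φ·Φ″ ≥ 0`)

Fourth part of the concavity budget (✓ `…ZeroChangeConcavityBudget`, `…Floor`, `…General`).  The abstract count of the first part is in fact
the card's DIP COUNT (`Ideas/arrangement-concavity-dip-count.md`: «Z₊(R) ≤ r + 2·N_dip», stated there for generic companies): the non-good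
off-root critical points are exactly the DIPS `𝔇 = {t > 0 : Φ′(t) = 0, Φ(t) ≠ 0, Φ(t)·Φ″(t) ≥ 0}` (local minima of `|Φ|` and degenerate
critical points), a set that is in general much SMALLER than the bad set `𝔅 = {M ≤ 0}` of the second part (by the pen's criterion
`𝔇 ⊆ 𝔅`, `card_dip_le_card_bad` below; a bad point may well be a local maximum — e.g. every critical point of a company of translated copies of
one `(+,−,−)` row is bad).  This file states the floor joint in the sharp currency:

* ★ `posCrit_le_dipBudget` — ANY real polynomial: `posCrit Φ ≤ 2·#𝔇 + 3·#{positive roots} + 1`;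
* `card_dip_le_card_bad` — for a company on `0 < a < c`: `#𝔇 ≤ #𝔅` (pen §56.7, ✓ `concavityCriterion_strict`);
* ★ `posCrit_prod_rows_le_dipBudget_of_oneChange` — one-change companies: `posCrit Φ ≤ 2·#𝔇 + 3m + 1`;
* ★ `floor_le_dipBudget` — Euler currency on every support `d₀ < d₁ < d₂` (unfolded as in ✓ `card_posRoots_euler_bottom_eq_posCrit`);
* ★★ `oneChangeFloorK3_of_dipBudget` — «`#𝔇 ≤ B·m + B` for every one-change company on every support `0 < u < w`» ⇒ the body of
  `OneChangeFloorK3` VERBATIM, constant `2B + 3`.  Converse trivial (`𝔇 ⊆` critical points), so the floor is EQUIVALENT to a linear dip budget;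
  the located expectation of the line (conjecture `(m−1) + 2V`, `V ≤ min(r/4, √m) + O(1)`) is that `#𝔇 = V` is even SUBLINEAR.

HONEST FRAMING: joint / helper, def-free, no named facts, no sorry, standard axioms; closes NO stub by name; `OneChangeFloorK3`, `EulerBoundK3`,
`ClassRowK3Linear`, `PPOPolyLaw`, `MatrixDescartes` (stmt-ValiantsHypothesis-18050) OPEN; `VP ≠ VNP` is NOT proved and nothing here bears on it.

[folklore] Elementary counting over the landed concavity-budget files; no citation needed.
-/

set_option linter.dupNamespace false

namespace Summit.ValiantsHypothesis.ValiantsHypothesis.Theorems.LacunarySymmetroidMatrixDescartes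

namespace ZeroChange

open Polynomial Finset Filter Topology

/-- ★ **DIP BUDGET, any real polynomial**: `posCrit Φ ≤ 2·#{t > 0 : Φ′(t) = 0, Φ(t) ≠ 0, Φ(t)Φ″(t) ≥ 0} + 3·#{t > 0 : Φ(t) = 0} + 1`. -/
theorem posCrit_le_dipBudget (Φ : ℝ[X]) :
    posCrit Φ ≤ 2 * (((derivative Φ).roots.toFinset.filter (fun t => 0 < t)).filter
        (fun t => Φ.eval t ≠ 0 ∧ 0 ≤ Φ.eval t * (derivative (derivative Φ)).eval t)).card
      + 3 * (Φ.roots.toFinset.filter (fun t => 0 < t)).card + 1 := by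
  classical
  have h4 := posCrit_le_two_mul_card_notGood_add Φ
  set S := (derivative Φ).roots.toFinset.filter (fun t => 0 < t) with hS
  set R := Φ.roots.toFinset.filter (fun t => 0 < t) with hR
  set N := S.filter (fun t => ¬ (Φ.eval t * (derivative (derivative Φ)).eval t < 0)) with hN
  set D := S.filter (fun t => Φ.eval t ≠ 0 ∧ 0 ≤ Φ.eval t * (derivative (derivative Φ)).eval t) with hD
  have hsub : N ⊆ R ∪ D := by
    intro t ht
    rw [hN, mem_filter] at ht
    obtain ⟨htS, hng⟩ := ht
    have htS' := htS
    rw [hS, mem_filter, Multiset.mem_toFinset] at htS'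
    obtain ⟨hmem, ht0⟩ := htS'
    have hΦ' : derivative Φ ≠ 0 := fun h => by rw [h, roots_zero] at hmem; exact Multiset.notMem_zero _ hmem
    have hΦ : Φ ≠ 0 := fun h => hΦ' (by rw [h, derivative_zero])
    by_cases hΦt : Φ.eval t = 0
    · refine mem_union_left _ ?_
      rw [hR, mem_filter, Multiset.mem_toFinset, mem_roots hΦ]
      exact ⟨hΦt, ht0⟩
    · refine mem_union_right _ ?_
      rw [hD, mem_filter]
      exact ⟨htS, hΦt, not_lt.1 hng⟩
  have hNle : N.card ≤ R.card + D.card := (card_le_card hsub).trans (card_union_le _ _)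
  omega

/-- **Dips are bad** (pen §56.7 through ✓ `concavityCriterion_strict`): for a company on `0 < a < c`, an off-root positive critical point
with `Φ·Φ″ ≥ 0` has `M ≤ 0`; hence `#𝔇 ≤ #𝔅`. -/
theorem card_dip_le_card_bad (m a c : ℕ) (ha : 0 < a) (hac : a < c) (co : Fin m → ℝ × ℝ × ℝ) :
    (((derivative (∏ j, row a c (co j).1 (co j).2.1 (co j).2.2)).roots.toFinset.filter (fun t => 0 < t)).filter
        (fun t => (∏ j, row a c (co j).1 (co j).2.1 (co j).2.2).eval t ≠ 0 ∧
          0 ≤ (∏ j, row a c (co j).1 (co j).2.1 (co j).2.2).eval t *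
            (derivative (derivative (∏ j, row a c (co j).1 (co j).2.1 (co j).2.2))).eval t)).card ≤
      (((derivative (∏ j, row a c (co j).1 (co j).2.1 (co j).2.2)).roots.toFinset.filter (fun t => 0 < t)).filter
        (fun t => (∏ j, row a c (co j).1 (co j).2.1 (co j).2.2).eval t ≠ 0 ∧ middleSum a c co t ≤ 0)).card := by
  classical
  set Φ : ℝ[X] := ∏ j, row a c (co j).1 (co j).2.1 (co j).2.2 with hΦdef
  refine card_le_card fun t ht => ?_
  rw [mem_filter] at ht ⊢
  obtain ⟨htS, hΦt, hge⟩ := ht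
  refine ⟨htS, hΦt, ?_⟩
  rw [mem_filter, Multiset.mem_toFinset] at htS
  obtain ⟨hmem, ht0⟩ := htS
  have hΦ' : derivative Φ ≠ 0 := fun h => by rw [h, roots_zero] at hmem; exact Multiset.notMem_zero _ hmem
  have hcrit : (derivative Φ).eval t = 0 := (mem_roots hΦ').1 hmem
  by_contra hM
  push Not at hM
  exact absurd (concavityCriterion_strict m a c ha hac co ht0 hΦt hcrit hM) (not_lt.2 hge)

/-- ★ **DIP BUDGET for a one-change company** (`0 < a < c`): `posCrit Φ ≤ 2·#𝔇 + 3m + 1`. -/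
theorem posCrit_prod_rows_le_dipBudget_of_oneChange (m a c : ℕ) (ha : 0 < a) (hac : a < c)
    (co : Fin m → ℝ × ℝ × ℝ) (hone : ∀ j, ¬ ((co j).1 * (co j).2.1 < 0 ∧ (co j).2.1 * (co j).2.2 < 0)) :
    posCrit (∏ j, row a c (co j).1 (co j).2.1 (co j).2.2) ≤
      2 * (((derivative (∏ j, row a c (co j).1 (co j).2.1 (co j).2.2)).roots.toFinset.filter (fun t => 0 < t)).filter
          (fun t => (∏ j, row a c (co j).1 (co j).2.1 (co j).2.2).eval t ≠ 0 ∧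
            0 ≤ (∏ j, row a c (co j).1 (co j).2.1 (co j).2.2).eval t *
              (derivative (derivative (∏ j, row a c (co j).1 (co j).2.1 (co j).2.2))).eval t)).card
        + 3 * m + 1 := by
  have h1 := posCrit_le_dipBudget (∏ j, row a c (co j).1 (co j).2.1 (co j).2.2)
  have h2 := card_posRoots_prod_rows_le_of_oneChange m a c ha hac co hone
  omega

/-- ★ **The floor in DIP currency**: on every support `d₀ < d₁ < d₂` and for every one-change company,
`Z₊(eulerNumerator d a 0) ≤ 2·#𝔇 + 3m + 1` (`eulerNumerator` unfolded as in ✓ `card_posRoots_euler_bottom_eq_posCrit`). -/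
theorem floor_le_dipBudget {m : ℕ} (d : Fin 3 → ℕ) (h01 : d 0 < d 1) (h12 : d 1 < d 2) (a : Fin m → Fin 3 → ℝ)
    (hone : ∀ j, ¬ (a j 0 * a j 1 < 0 ∧ a j 1 * a j 2 < 0)) :
    ((∑ j, (∑ l, C (a j l * ((d l : ℝ) - d 0)) * X ^ (d l)) * ∏ i ∈ Finset.univ.erase j, (∑ l, C (a i l) * X ^ (d l))
        : ℝ[X]).roots.toFinset.filter (fun t => 0 < t)).card
      ≤ 2 * (((derivative (∏ j, row (d 1 - d 0) (d 2 - d 0) (a j 0) (a j 1) (a j 2))).roots.toFinset.filter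
            (fun t => 0 < t)).filter
          (fun t => (∏ j, row (d 1 - d 0) (d 2 - d 0) (a j 0) (a j 1) (a j 2)).eval t ≠ 0 ∧
            0 ≤ (∏ j, row (d 1 - d 0) (d 2 - d 0) (a j 0) (a j 1) (a j 2)).eval t *
              (derivative (derivative (∏ j, row (d 1 - d 0) (d 2 - d 0) (a j 0) (a j 1) (a j 2)))).eval t)).card
        + 3 * m + 1 := by
  rw [card_posRoots_euler_bottom_eq_posCrit d h01.le (h01.le.trans h12.le) a]
  exact posCrit_prod_rows_le_dipBudget_of_oneChange m (d 1 - d 0) (d 2 - d 0) (by omega) (by omega)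
    (fun j => (a j 0, a j 1, a j 2)) (fun j => hone j)

/-- ★★ **`OneChangeFloorK3` FROM A LINEAR DIP BUDGET** (the card's C⁺ exactly, for ALL companies): if every one-change company on every support
`0 < u < w` has at most `B·m + B` dips (off-root positive critical points with `Φ·Φ″ ≥ 0`), then the body of `OneChangeFloorK3` holds verbatim
with constant `2B + 3`. -/
theorem oneChangeFloorK3_of_dipBudget (B : ℕ)
    (hbudget : ∀ (m u w : ℕ), 0 < u → u < w → ∀ (co : Fin m → ℝ × ℝ × ℝ),
      (∀ j, ¬ ((co j).1 * (co j).2.1 < 0 ∧ (co j).2.1 * (co j).2.2 < 0)) →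
      (((derivative (∏ j, row u w (co j).1 (co j).2.1 (co j).2.2)).roots.toFinset.filter (fun t => 0 < t)).filter
          (fun t => (∏ j, row u w (co j).1 (co j).2.1 (co j).2.2).eval t ≠ 0 ∧
            0 ≤ (∏ j, row u w (co j).1 (co j).2.1 (co j).2.2).eval t *
              (derivative (derivative (∏ j, row u w (co j).1 (co j).2.1 (co j).2.2))).eval t)).card
        ≤ B * m + B) :
    ∃ C' : ℕ, ∀ (m : ℕ) (d : Fin 3 → ℕ) (a : Fin m → Fin 3 → ℝ), d 0 < d 1 → d 1 < d 2 →
      (∀ j, ¬ (a j 0 * a j 1 < 0 ∧ a j 1 * a j 2 < 0)) →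
      ((∑ j, (∑ l, C (a j l * ((d l : ℝ) - d 0)) * X ^ (d l)) * ∏ i ∈ Finset.univ.erase j, (∑ l, C (a i l) * X ^ (d l))
          : ℝ[X]).roots.toFinset.filter (fun t => 0 < t)).card ≤ C' * m + C' := by
  refine ⟨2 * B + 3, fun m d a h01 h12 hone => ?_⟩
  have h1 := floor_le_dipBudget d h01 h12 a hone
  have h2 : (((derivative (∏ j, row (d 1 - d 0) (d 2 - d 0) (a j 0) (a j 1) (a j 2))).roots.toFinset.filter
            (fun t => 0 < t)).filter
          (fun t => (∏ j, row (d 1 - d 0) (d 2 - d 0) (a j 0) (a j 1) (a j 2)).eval t ≠ 0 ∧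
            0 ≤ (∏ j, row (d 1 - d 0) (d 2 - d 0) (a j 0) (a j 1) (a j 2)).eval t *
              (derivative (derivative (∏ j, row (d 1 - d 0) (d 2 - d 0) (a j 0) (a j 1) (a j 2)))).eval t)).card
        ≤ B * m + B :=
    hbudget m (d 1 - d 0) (d 2 - d 0) (by omega) (by omega) (fun j => (a j 0, a j 1, a j 2)) (fun j => hone j)
  have h3 : (2 * B + 3) * m + (2 * B + 3) = 2 * (B * m + B) + 3 * m + 1 + 2 := by ring
  rw [h3]
  omega

end ZeroChange

end Summit.ValiantsHypothesis.ValiantsHypothesis.Theorems.LacunarySymmetroidMatrixDescartes
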